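import Literature.Analysis.FluidPDE.SereginZhou2020
import Literature.Analysis.FluidPDE.SuitableWeakCongr
import HarnessLib

/-!
# Seregin–Zhou 2020, the axisymmetric corollary: first reductions (proofs only)

Analysis/FluidPDE proof file (theorems only; no definitions, no named facts) towards the discharge
of the named fact `Literature.Analysis.FluidPDE.SereginZhou2020.axisymmetric_regular`
(`SereginZhou2020.lean`; G. Seregin, D. Zhou, J. Math. Sci. 244 (2020) = arXiv:1802.03600,
abstract and §1, remark after Def. 1.3: axially symmetric suitable weak solutions in
`L_∞(0,T; Ḃ^{-1}_{∞,∞})` are regular). The printed argument is: by Thm 1.2 all scaled energies are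
bounded, so every singular point would be of Type I (Def. 1.3), and "arguments used in
[Seregin 2012] show that axially symmetric suitable weak solutions have no Type I blowups" — in
the tree the latter is the named fact `Seregin2020_axisymmetricSingularPoint_typeII` (Seregin 2020,
Thm 2.1, `Seregin2020AxisymmetricTypeII.lean`), stated for fields ALL of whose time slices are
axisymmetric, at the origin of the unit cylinder.

This file lands the representative-choosing step of the glue, which the paper passes over in
silence (axial symmetry of an `L³_{loc}` class versus of a representative):

* `Hypotheses.congr_slice` — the hypothesis bundle `SereginZhou2020.Hypotheses T v q G`
  (suitable weak solution on the slab `(0,T) × ℝ³`, weak gradient, energy class up to `T`,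
  `Ḃ^{-1}_{∞,∞}` bound a.e. in time) is invariant under modification of `v` on a null set of time
  slices in `(0,T)` (every clause sees `v` through space–time integrals or `∀ᵐ t`; the accepted
  `IsSuitableWeakSolutionOn.congr_ae`, `HasWeakSpatialGradientOn.congr_ae`, `SuitableWeakCongr.lean`);
* `Hypotheses.axisymmetrize` — hence a solution axisymmetric at a.e. time slice may be replaced by
  one axisymmetric at EVERY time (`v' t = v t` if `v t` is axisymmetric, `0` otherwise) with the
  same `q`, `G`, all hypotheses, and `v' = v` at a.e. `t ∈ (0,T)`;
* `eLpNorm_parabolicCylinder_congr_slice` — for such `v'` the `L^∞` norms of `v` and `v'` on every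
  backward cylinder `Q(z₀,r) ⊆ [0,T] × ℝ³` agree;
* `axisymmetric_regular_of_forall_slices` — CONSEQUENTLY `axisymmetric_regular` follows from its
  special case in which every slice `v t`, `t ∈ ℝ`, is axisymmetric (the form in which Seregin
  2020, Thm 2.1 is vendored);
* `limsup_nhdsGT_le_biSup` — bookkeeping between the conclusion of Thm 1.2 (`⨆` over
  `0 < r < r₀`) and the blow-up index of Seregin 2020 (`limsup_{r → 0⁺}`): `limsup ≤ ⨆`.

Still missing for `axisymmetric_regular_holds` (see the seat's NOTES): Thm 1.2 itself in a
robust form (`limsup_{r→0} C(z₀,r) < ∞`; the genuine-`sup` rendering `scaledEnergies_lt_top` is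
refuted in `SereginZhou2020Counterexample.lean`), the discharge of
`Seregin2020_axisymmetricSingularPoint_typeII`, rotation covariance of suitable weak solutions and
the angular averaging of the pressure, and the centring/zoom onto the unit cylinder
(`IsSuitableWeakSolutionOn.stRescale`).

## References

* G. Seregin, D. Zhou, *Regularity of solutions to the Navier–Stokes equations in
  `Ḃ^{-1}_{∞,∞}`*, J. Math. Sci. 244 (2020) 1003–1009, arXiv:1802.03600, §1 (Def. 1.1, Thm 1.2,
  Def. 1.3 and the remark following it). [`SereginZhou2020`]
* G. Seregin, *Local regularity of axisymmetric solutions to the Navier–Stokes equations*, Anal.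
  Math. Phys. 10 (2020), Thm 2.1. [`Seregin2020`]
* L. Caffarelli, R. Kohn, L. Nirenberg, CPAM 35 (1982), §2 (classes, not representatives).
  [`CaffarelliKohnNirenberg1982`]
-/

noncomputable section

open MeasureTheory Set Metric Function Filter TopologicalSpace
open scoped ENNReal NNReal Topology
open Literature.Analysis.UnboundedOperators

namespace Literature.Analysis.FluidPDE

namespace SereginZhou2020

variable {T : ℝ} {v v' : ℝ → EuclideanSpace ℝ (Fin 3) → EuclideanSpace ℝ (Fin 3)}
  {q : ℝ → EuclideanSpace ℝ (Fin 3) → ℝ}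
  {G : ℝ → EuclideanSpace ℝ (Fin 3) → EuclideanSpace ℝ (Fin 3) →L[ℝ] EuclideanSpace ℝ (Fin 3)}

/-! ### Modifying the velocity on a null set of time slices -/

/-- Two fields whose slices agree at a.e. time `t ∈ (0,T)` agree a.e. on the slab
`(0,T) × ℝ³` (w.r.t. Lebesgue measure restricted to the slab). [folklore] -/
theorem ae_restrict_slab_of_ae_slice (h : ∀ᵐ t : ℝ, t ∈ Ioo 0 T → v' t = v t) :
    ∀ᵐ z ∂(volume.restrict ((slab (EuclideanSpace ℝ (Fin 3)) (Ioo 0 T) isOpen_Ioo :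
        Opens (ℝ × EuclideanSpace ℝ (Fin 3))) : Set (ℝ × EuclideanSpace ℝ (Fin 3)))),
      uncurry v z = uncurry v' z := by
  have hprod : ∀ᵐ z : ℝ × EuclideanSpace ℝ (Fin 3), z.1 ∈ Ioo 0 T → v' z.1 = v z.1 := by
    rw [Measure.volume_eq_prod]
    exact Measure.quasiMeasurePreserving_fst.ae h
  have hmeas : MeasurableSet ((slab (EuclideanSpace ℝ (Fin 3)) (Ioo 0 T) isOpen_Ioo :
      Opens (ℝ × EuclideanSpace ℝ (Fin 3))) : Set (ℝ × EuclideanSpace ℝ (Fin 3))) :=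
    (slab (EuclideanSpace ℝ (Fin 3)) (Ioo 0 T) isOpen_Ioo).isOpen.measurableSet
  filter_upwards [ae_restrict_mem hmeas, ae_restrict_of_ae hprod] with z hz hz'
  have ht : z.1 ∈ Ioo 0 T := mem_slab.1 hz
  simp only [uncurry, hz' ht]

/-- **The hypotheses of Thm 1.2 do not see null sets of time slices.** If `(T, v, q, G)` satisfy
`Hypotheses T v q G` and `v' t = v t` for a.e. `t ∈ (0,T)`, then so do `(T, v', q, G)`: the
suitable-weak-solution structure and the weak gradient transfer by the accepted a.e.-modification
lemmas (`SuitableWeakCongr.lean`), the energy class of Def. 1.1 (i) and the `Ḃ^{-1}_{∞,∞}` bound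
(1.1) are `∀ᵐ t` statements. (CKN 1982, §2 and Seregin–Zhou 2020, Def. 1.1 speak of classes.)
[cite: SereginZhou2020, Def. 1.1 and (1.1)] -/
theorem Hypotheses.congr_slice (hyp : Hypotheses T v q G)
    (h : ∀ᵐ t : ℝ, t ∈ Ioo 0 T → v' t = v t) : Hypotheses T v' q G where
  pos := hyp.pos
  suitable := hyp.suitable.congr_ae (ae_restrict_slab_of_ae_slice h) (ae_of_all _ fun _ => rfl)
  weakGradient := hyp.weakGradient.congr_ae (ae_restrict_slab_of_ae_slice h)
  energyClass := by
    intro δ hδ hδT x R hR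
    obtain ⟨⟨C, hC⟩, hG, hq⟩ := hyp.energyClass δ hδ hδT x R hR
    refine ⟨⟨C, ?_⟩, hG, hq⟩
    filter_upwards [hC, h] with t ht ht' htδ
    rw [ht' ⟨hδ.trans htδ.1, htδ.2⟩]
    exact ht htδ
  besov := by
    obtain ⟨M, hM⟩ := hyp.besov
    refine ⟨M, ?_⟩
    filter_upwards [hM, h] with t ht ht' ht0
    rw [ht' ht0]
    exact ht ht0

/-- **Choosing an everywhere-axisymmetric representative.** Under `Hypotheses T v q G`, if a.e.
slice `v t`, `t ∈ (0,T)`, is axisymmetric, then the field `v'` equal to `v t` at the axisymmetric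
slices and to `0` at the others is axisymmetric at EVERY time, satisfies `Hypotheses T v' q G`
(`Hypotheses.congr_slice`), and `v' t = v t` for a.e. `t ∈ (0,T)`. This is the (tacit) passage from
"axially symmetric suitable weak solution" as a class (Seregin–Zhou 2020, abstract; Seregin 2020,
§2) to the pointwise-in-time symmetry under which Seregin 2020, Thm 2.1 is vendored.
[cite: SereginZhou2020, abstract and §1 (remark after Def. 1.3)] -/
theorem Hypotheses.axisymmetrize (hyp : Hypotheses T v q G)
    (hax : ∀ᵐ t : ℝ, t ∈ Ioo 0 T → IsAxisymmetric (v t)) :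
    ∃ v' : ℝ → EuclideanSpace ℝ (Fin 3) → EuclideanSpace ℝ (Fin 3),
      (∀ t, IsAxisymmetric (v' t)) ∧ Hypotheses T v' q G ∧ ∀ᵐ t : ℝ, t ∈ Ioo 0 T → v' t = v t := by
  classical
  have h0 : IsAxisymmetric (0 : EuclideanSpace ℝ (Fin 3) → EuclideanSpace ℝ (Fin 3)) := by
    intro θ x
    ext i
    fin_cases i <;> simp
  have hv' : ∀ᵐ t : ℝ, t ∈ Ioo 0 T →
      (fun t => if IsAxisymmetric (v t) then v t else 0) t = v t :=
    hax.mono fun t ht htT => by simp [ht htT]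
  refine ⟨fun t => if IsAxisymmetric (v t) then v t else 0, fun t => ?_, hyp.congr_slice hv', hv'⟩
  by_cases h : IsAxisymmetric (v t)
  · simp only [if_pos h]
    exact h
  · simp only [if_neg h]
    exact h0

/-! ### The conclusion does not see null sets of time slices either -/

/-- A backward cylinder `Q(z₀, r)` with `r² ≤ t₀ ≤ T` lies in the closed strip `[0, T] × ℝ³`
(its time window is `(t₀ - r², t₀) ⊆ [0, T)`). [folklore] -/
theorem parabolicCylinder_subset_Icc_prod {t₀ r : ℝ} (hr : r ^ 2 ≤ t₀) (ht₀ : t₀ ≤ T)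
    (x₀ : EuclideanSpace ℝ (Fin 3)) :
    parabolicCylinder r ((t₀, x₀) : ℝ × EuclideanSpace ℝ (Fin 3)) ⊆ Icc 0 T ×ˢ univ := by
  intro z hz
  rw [mem_parabolicCylinder] at hz
  exact ⟨⟨by linarith [hz.1.1], hz.1.2.le.trans ht₀⟩, mem_univ _⟩

/-- **The `L^∞(Q(z₀,r))` norm does not see null sets of time slices**: if `v' t = v t` for a.e.
`t ∈ (0,T)` and `Q(z₀,r) ⊆ [0,T] × ℝ³` (`r² ≤ t₀ ≤ T`), then `‖v'‖_{L^∞(Q(z₀,r))} =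
‖v‖_{L^∞(Q(z₀,r))}`. [folklore] -/
theorem eLpNorm_parabolicCylinder_congr_slice (h : ∀ᵐ t : ℝ, t ∈ Ioo 0 T → v' t = v t)
    {t₀ r : ℝ} (hr : r ^ 2 ≤ t₀) (ht₀ : t₀ ≤ T) (x₀ : EuclideanSpace ℝ (Fin 3)) :
    eLpNorm (uncurry v') ∞ (volume.restrict (parabolicCylinder r
        ((t₀, x₀) : ℝ × EuclideanSpace ℝ (Fin 3)))) =
      eLpNorm (uncurry v) ∞ (volume.restrict (parabolicCylinder r
        ((t₀, x₀) : ℝ × EuclideanSpace ℝ (Fin 3)))) := by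
  refine eLpNorm_congr_ae ?_
  -- a.e. on `ℝ × ℝ³`: off the null slices `{t = 0}`, `{bad t ∈ (0,T)}`, inside `[0,T] × ℝ³`, the
  -- fields agree
  have hprod : ∀ᵐ z : ℝ × EuclideanSpace ℝ (Fin 3), z.1 ∈ Ioo 0 T → v' z.1 = v z.1 := by
    rw [Measure.volume_eq_prod]
    exact Measure.quasiMeasurePreserving_fst.ae h
  have hzero : ∀ᵐ z : ℝ × EuclideanSpace ℝ (Fin 3), z.1 ≠ 0 := by
    rw [Measure.volume_eq_prod]
    exact Measure.quasiMeasurePreserving_fst.ae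
      (measure_eq_zero_iff_ae_notMem.1 (Real.volume_singleton (a := 0)))
  have hmeas : MeasurableSet (parabolicCylinder r ((t₀, x₀) : ℝ × EuclideanSpace ℝ (Fin 3))) :=
    (isOpen_parabolicCylinder r _).measurableSet
  filter_upwards [ae_restrict_mem hmeas, ae_restrict_of_ae hprod, ae_restrict_of_ae hzero]
    with z hz hz' hz0
  have hzT := parabolicCylinder_subset_Icc_prod hr ht₀ x₀ hz
  rw [mem_parabolicCylinder] at hz
  have ht : z.1 ∈ Ioo 0 T :=
    ⟨lt_of_le_of_ne hzT.1.1 (Ne.symm hz0), lt_of_lt_of_le hz.1.2 ht₀⟩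
  simp only [uncurry, hz' ht]

/-! ### Reduction of the corollary to everywhere-axisymmetric fields -/

/-- **`axisymmetric_regular` follows from its special case with ALL slices axisymmetric.** If
for every `(T, v, q, G)` with `Hypotheses T v q G` and `v t` axisymmetric for EVERY `t ∈ ℝ` each
point `z₀ = (t₀, x₀)`, `t₀ ∈ (0,T]`, has a backward cylinder on which `v` is essentially bounded,
then the same holds when the slices are axisymmetric only for a.e. `t ∈ (0,T)` — the form in
which `axisymmetric_regular` is stated: replace `v` by its everywhere-axisymmetric representative
(`Hypotheses.axisymmetrize`), shrink the cylinder below `r² ≤ t₀`, and transfer the `L^∞` bound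
back (`eLpNorm_parabolicCylinder_congr_slice`).
[cite: SereginZhou2020, abstract and §1 (remark after Def. 1.3)] -/
theorem axisymmetric_regular_of_forall_slices
    (H : ∀ (T : ℝ) (v : ℝ → EuclideanSpace ℝ (Fin 3) → EuclideanSpace ℝ (Fin 3))
      (q : ℝ → EuclideanSpace ℝ (Fin 3) → ℝ)
      (G : ℝ → EuclideanSpace ℝ (Fin 3) → EuclideanSpace ℝ (Fin 3) →L[ℝ] EuclideanSpace ℝ (Fin 3)),
      Hypotheses T v q G → (∀ t, IsAxisymmetric (v t)) →
        ∀ t₀ ∈ Ioc 0 T, ∀ x₀ : EuclideanSpace ℝ (Fin 3), ∃ r > 0,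
          eLpNorm (uncurry v) ∞ (volume.restrict (parabolicCylinder r (t₀, x₀))) < ∞) :
    axisymmetric_regular := by
  intro T v q G hyp hax t₀ ht₀ x₀
  obtain ⟨v', hv'ax, hyp', hv'⟩ := hyp.axisymmetrize hax
  obtain ⟨r, hr, hbound⟩ := H T v' q G hyp' hv'ax t₀ ht₀ x₀
  -- shrink the radius so that the cylinder stays above `t = 0`
  set ρ : ℝ := min r (Real.sqrt t₀) with hρ
  have hρpos : 0 < ρ := lt_min hr (Real.sqrt_pos.2 ht₀.1)
  have hρr : ρ ≤ r := min_le_left _ _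
  have hρt : ρ ^ 2 ≤ t₀ := by
    calc ρ ^ 2 ≤ Real.sqrt t₀ ^ 2 :=
          pow_le_pow_left₀ hρpos.le (min_le_right _ _) 2
      _ = t₀ := Real.sq_sqrt ht₀.1.le
  -- `Q(z₀, ρ) ⊆ Q(z₀, r)` (cf. `parabolicCylinder_mono`, `CKN1982Setting.lean`)
  have hsub : parabolicCylinder ρ ((t₀, x₀) : ℝ × EuclideanSpace ℝ (Fin 3)) ⊆
      parabolicCylinder r ((t₀, x₀) : ℝ × EuclideanSpace ℝ (Fin 3)) := by
    have h2 : ρ ^ 2 ≤ r ^ 2 := pow_le_pow_left₀ hρpos.le hρr 2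
    exact prod_mono (Ioo_subset_Ioo (by linarith) le_rfl) (ball_subset_ball hρr)
  refine ⟨ρ, hρpos, ?_⟩
  rw [← eLpNorm_parabolicCylinder_congr_slice hv' hρt ht₀.2 x₀]
  exact lt_of_le_of_lt (eLpNorm_mono_measure _ (Measure.restrict_mono hsub le_rfl)) hbound

/-! ### `limsup_{r → 0⁺} ≤ sup_{0 < r < r₀}` -/

/-- For `r₀ > 0`, the upper limit of `f` along `r → 0⁺` is at most the supremum of `f` over
`0 < r < r₀` (the conclusion of Thm 1.2 controls the blow-up index `g(z₀)` of Def. 1.3 /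
Seregin 2020, Def. 1.7). [folklore] -/
theorem limsup_nhdsGT_le_biSup {f : ℝ → ℝ≥0∞} {r₀ : ℝ} (hr₀ : 0 < r₀) :
    limsup f (𝓝[>] (0 : ℝ)) ≤ ⨆ r ∈ Ioo 0 r₀, f r := by
  refine limsup_le_of_le (by isBoundedDefault) ?_
  filter_upwards [Ioo_mem_nhdsGT hr₀] with r hr
  exact le_iSup₂_of_le (f := fun r (_ : r ∈ Ioo 0 r₀) => f r) r hr le_rfl

/-- In particular, under the conclusion of Thm 1.2 at `z₀` (in any rendering bounding
`⨆_{0<r<r₀} C(z₀,r)`), the scaled cubic quantity has finite upper limit at `z₀`, i.e. `z₀` could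
only be a Type I singularity (Def. 1.3). [cite: SereginZhou2020, Def. 1.3 (remark: Type I only)] -/
theorem limsup_cknC_lt_top_of_biSup_lt_top {z₀ : ℝ × EuclideanSpace ℝ (Fin 3)}
    {u : ℝ → EuclideanSpace ℝ (Fin 3) → EuclideanSpace ℝ (Fin 3)} {r₀ : ℝ} (hr₀ : 0 < r₀)
    (h : (⨆ r ∈ Ioo 0 r₀, cknC r z₀ u) < ∞) :
    limsup (fun r => cknC r z₀ u) (𝓝[>] (0 : ℝ)) < ∞ :=
  lt_of_le_of_lt (limsup_nhdsGT_le_biSup hr₀) h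

end SereginZhou2020

end Literature.Analysis.FluidPDE

end
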